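import Summits.ValiantsHypothesis.ValiantsHypothesis.Theses.ShallowShadows
import Literature.Computability.AlgebraicComplexity.DepthThreeChasmCircuits
import Literature.Computability.AlgebraicComplexity.RealTauConjectureDepthFour
import Literature.Computability.Complexity.KWProtocol
import Literature.Computability.Complexity.KWProtocolFormula
import Summits.ValiantsHypothesis.ValiantsHypothesis.Theorems.ChowBorderDepth3Depth3ChasmPaddedChasm
import Summits.ValiantsHypothesis.ValiantsHypothesis.Theorems.ShallowShadowsShadowFormulaTransferSpsData
import Summits.ValiantsHypothesis.ValiantsHypothesis.Theorems.ShallowShadowsShadowFormulaTransferWindow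
import Summits.ValiantsHypothesis.ValiantsHypothesis.Theorems.ShallowShadowsShadowFormulaTransferOneProductShadow
import Summits.ValiantsHypothesis.ValiantsHypothesis.Theorems.ShallowShadowsShadowFormulaTransferAffineCoverShallow
import Summits.ValiantsHypothesis.ValiantsHypothesis.Theorems.ShallowShadowsShadowFormulaTransferTwoProductDeadCase
import Summits.ValiantsHypothesis.ValiantsHypothesis.Theorems.ShallowShadowsShadowFormulaTransferGridRigidity
import Summits.ValiantsHypothesis.ValiantsHypothesis.Theorems.ShallowShadowsShadowFormulaTransferBetFarSide

/-!
# Crux `ShadowFormulaTransfer` (stmt-ValiantsHypothesis-17124) — line `Sketch`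
# (DEPTH-THREE CHASM: products are free, the one sum is an identity), lead c2's registered skeleton

The crux X (route `ShallowShadows`): `∃ δ > 0, ∃ C, ∀ 0/1-coefficient VP_ℂ families f, eventually
in n, L_mon-formula(B f_n) ≤ 2 ^ (deg(f_n)^{1-δ} (log(n+2))^C + C)`, where the SHADOW of a polynomial
`g` is the monotone Boolean function `B g : a ↦ [∃ monomial of g with support ⊆ a]`.

THE LINE (cards `Ideas/chasm3-identity-game.md` + `Ideas/fourier-lift-logrank.md`, ideator
`planner-cruxidea-…-2-0`, sketch `Sketch.lean`). Every level of a VP_ℂ family is a `ΣΠΣ` circuit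
`g = Σ_{τ<T} c_τ Π_{π<D} ℓ_{τπ}` (affine `ℓ`) with `log T, log D = O(√d · polylog(n))` — the
depth-three chasm (GKKS 2016 / Tavenas 2015), PROVED in the tree and already padded to arbitrary
finite variable types (`ChowBorderDepth3Depth3Chasm.stub_paddedChasm`). The shadow is
multiplicative over a domain (`B(gh) = B g ∧ B h`), so in the monotone Karchmer–Wigderson game of
`B g` product gates and affine leaves are free and ALL difficulty sits at the single sum gate,
whose cancellations are `ΣΠΣ(T)` identities. The line's bet `Depth3Shadow` (κ < 2): the monotone
formula size `L` of the shadow of a `0/1` sum of `T` products of `D` affine forms in `N` variables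
obeys `log₂(L+1) ≤ (log₂(T+2))^κ (log₂(N+2))^K + K log₂(D+2) + K`. With the chasm's
`log T = Õ(√d)` this is X with `δ = 1 − κ/2`.

THE STUBS (9 registered; after waves 1–2 of cycle 1: 7 LANDED, 2 open — the bet `stub_depth3Shadow` and
the T = 2 first bite `stub_twoProductShadow`; wave 2 landed `stub_twoProductDeadCase` p170024,
`stub_gridRigidity` p170206, `stub_betFarSide` p170510, see their docstrings):
* `stub_depth3Shadow` — THE LINE'S BET (conjecture-grade, OPEN, held by the lead; STRONGER than X:
  with RW92 it gives `2^{m^{1/κ}}` `ΣΠΣ` lower bounds for `per_ℂ`).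
* `stub_spsData` — explicit `ΣΠΣ` data from a product-depth-`≤ 1` circuit: `T, D ≤ wires + 1`
  (the data behind `exists_size_le_of_productDepth_le_one`): provable now, size M.
* `stub_window` — the real bookkeeping `(log T)^κ polylog + K log D + K ≤ d^{κ/2}(log(n+2))^C + C`
  eventually, constants of the family absorbed by `n ≥ n₀`: provable now, size M.
* `stub_oneProductShadow` — first bite T ≤ 1: the shadow of one product of affine forms is a CNF,
  `L ≤ 4(D+1)(N+1)`: provable now, size S/M.
* `stub_twoProductShadow` — first bite T = 2 (the card's first lemma `TwoProductShadow`): a 0/1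
  difference of two products of affine forms casts a poly-size shadow. Held by the lead; the
  disprover's natural target (a DEEP two-product family would refute X itself).
* `stub_affineCoverShallow` — Fourier-lift calibration (card fourier-lift-logrank, first lemma):
  box-SAT of a set with an affine cover of `M` pieces cut out by `≤ D` parities each has monotone
  formulas of size `(M+1) 2^{KD} (n+2)^K` (leaf + violated parity + parity binary search):
  provable now, size L.
* `ShadowFormulaTransfer_of : stub_depth3Shadow → X` (after wave 1; `stub_spsData`, `stub_window`
  discharged inside from the tree) — the composition, PROVED here sorry-free (padded chasm from the tree; empty/constant shadows are the
  junk value `0`). STATE after wave 1: its only open hypothesis is the bet `stub_depth3Shadow`.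

References: Gupta–Kamath–Kayal–Saptharishi 2016 Thm 1.1; Tavenas 2015 Cor. 1; Karchmer–Wigderson
1990 §2; Saxena–Seshadhri arXiv:1002.0145 (ΣΠΣ(k) identities); Tsang–Wong–Xie–Zhang
arXiv:1304.1245 (Fourier sparsity); Raz–Wigderson 1992 (far side).
-/

-- Sub = Summit single-conjunct layout: the duplicated namespace component is mandated by the tree.
set_option linter.dupNamespace false

noncomputable section

namespace Summit.ValiantsHypothesis.ValiantsHypothesis.Cruxes.ShadowFormulaTransfer.Chasm3

open Summit.ValiantsHypothesis.ValiantsHypothesis.Theses.ShallowShadows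
open Literature.Computability.AlgebraicComplexity Literature.Computability.Complexity
open Literature.Computability.AlgebraicComplexity.DepthThreeChasm

/-! ## The stub statements, named -/

/-- **DEPTH-THREE SHADOW** (stub statement, named; the line's bet, conjecture-grade): there are
`κ < 2` and `K` such that for every finite variable type `ι` (`N = #ι`) and every sum of `T`
products of `D` affine forms over `ℂ` whose total coefficients are all `0` or `1`, the monotone
formula size `L` of its shadow satisfies
`log₂(L + 1) ≤ (log₂(T+2))^κ · (log₂(N+2))^K + K · log₂(D+2) + K`.
Products and affine leaves are free in the shadow's monotone KW game; the top fan-in `T` governs.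
Far side: `per_m` (Ryser/Glynn, `T = 2^m`) has shadow `PM_m` of size `2^{Θ(m)}` (RW92), so
`κ ≥ 1`. [conjecture-grade: arXiv:1002.0145 (identity structure), RazWigderson1992 (far side),
arXiv:2512.19515 §1.3] -/
def Depth3Shadow : Prop :=
  ∃ κ : ℝ, κ < 2 ∧ ∃ K : ℕ, ∀ (ι : Type) [Fintype ι] [DecidableEq ι] (T D : ℕ) (c : Fin T → ℂ)
    (ℓ : Fin T → Fin D → (ι → ℂ) × ℂ),
    (∀ m : ι →₀ ℕ, (∑ τ, c τ • ∏ π, affVal (ℓ τ π)).coeff m = 0 ∨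
      (∑ τ, c τ • ∏ π, affVal (ℓ τ π)).coeff m = 1) →
    Real.logb 2 ((formulaSizeOver monotoneBasis (fun a : ι → Bool =>
        decide (∃ m ∈ (∑ τ, c τ • ∏ π, affVal (ℓ τ π)).support, ∀ i ∈ m.support, a i = true)) : ℝ)
        + 1) ≤
      Real.logb 2 (T + 2) ^ κ * Real.logb 2 (Fintype.card ι + 2) ^ K + K * Real.logb 2 (D + 2) + K

/-- **EXPLICIT `ΣΠΣ` DATA** (stub statement, named): a circuit of product-depth `≤ 1` over `ℂ`
computes a sum of `T ≤ wires + 1` terms `c_τ · Π_{π<D} ℓ_{τπ}` with `D ≤ wires + 1` affine factors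
each (sum closure at the output; operands of product-depth `0` denote affine forms; operand-free
product gates denote `1`; short products padded with the affine form `1`). The data behind the
tree's `exists_size_le_of_productDepth_le_one`. [folklore; GKKS 2016 §1 eq. (1)] -/
def SpsData : Prop :=
  ∀ (ι : Type) [Fintype ι] [DecidableEq ι] (P : ArithCircuit ℂ ι), P.productDepth ≤ 1 →
    ∃ (T D : ℕ) (c : Fin T → ℂ) (ℓ : Fin T → Fin D → (ι → ℂ) × ℂ),
      (∑ τ, c τ • ∏ π, affVal (ℓ τ π)) = P.eval ∧ T ≤ P.edgeSize + 1 ∧ D ≤ P.edgeSize + 1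

/-- **THE WINDOW** (stub statement, named; pure real bookkeeping): for `1 ≤ κ ≤ 2` and `K` there
is `C` (depending on `K` only) such that for all constants `K₁, c` of a family, eventually in `n`,
whenever `d ≥ 1`, `m, s, N ≤ (n+2)^c` and `T + 2, D + 2 ≤ 2^(K₁ ⌊√(d (log₂ m + 1)(log₂ s + 1))⌋ + K₁ + 2)`,
`(log₂(T+2))^κ (log₂(N+2))^K + K log₂(D+2) + K ≤ d^{κ/2} (log(n+2))^C + C`. [folklore] -/
def Window : Prop :=
  ∀ (κ : ℝ) (K : ℕ), 1 ≤ κ → κ ≤ 2 → ∃ C : ℕ, ∀ (K₁ c : ℕ), ∃ n₀ : ℕ,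
    ∀ (n d m s N T D : ℕ), n₀ ≤ n → 1 ≤ d → m ≤ (n + 2) ^ c → s ≤ (n + 2) ^ c →
      N ≤ (n + 2) ^ c →
      T + 2 ≤ 2 ^ (K₁ * Nat.sqrt (d * (Nat.log 2 m + 1) * (Nat.log 2 s + 1)) + K₁ + 2) →
      D + 2 ≤ 2 ^ (K₁ * Nat.sqrt (d * (Nat.log 2 m + 1) * (Nat.log 2 s + 1)) + K₁ + 2) →
      Real.logb 2 (T + 2) ^ κ * Real.logb 2 (N + 2) ^ K + K * Real.logb 2 (D + 2) + K ≤
        (d : ℝ) ^ (κ / 2) * Real.log (n + 2) ^ C + C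

/-- **ONE PRODUCT** (stub statement, named; first bite `T ≤ 1`): the shadow of `c · Π_{π<D} ℓ_π`
(`ℓ_π` affine over `ℂ`, `N = #ι`) is, over the domain `ℂ`, the CNF
`∧_{π : ℓ_π(0) = 0} ∨_{i ∈ supp ℓ_π} x_i` (or a constant, junk value `0`), so its monotone
formula size is at most `4 (D+1) (N+1)` (Bob names a dead factor, Alice a live variable of it).
[folklore; KarchmerWigderson1990 §2] -/
def OneProductShadow : Prop :=
  ∀ (ι : Type) [Fintype ι] [DecidableEq ι] (D : ℕ) (c : ℂ) (ℓ : Fin D → (ι → ℂ) × ℂ),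
    formulaSizeOver monotoneBasis (fun a : ι → Bool =>
        decide (∃ m ∈ (c • ∏ π, affVal (ℓ π)).support, ∀ i ∈ m.support, a i = true)) ≤
      4 * (D + 1) * (Fintype.card ι + 1)

/-- **TWO PRODUCTS** (stub statement, named; first bite `T = 2`, the card's first lemma
`TwoProductShadow`): a `0/1`-coefficient combination `α Π φ_π + β Π ψ_π` of two products of `D`
affine forms over `ℂ` in `N` variables casts a shadow of monotone formula size `≤ (N + D + 2)^K`.
Protocol behind it (card): strip the gcd; a product dead on Bob's side is a CNF step; cancelling
restrictions give a projective matching of restricted forms by unique factorisation; the open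
sub-case is "both products alive on both sides". [conjecture-grade: chasm3-identity-game card;
arXiv:1002.0145] -/
def TwoProductShadow : Prop :=
  ∃ K : ℕ, ∀ (ι : Type) [Fintype ι] [DecidableEq ι] (D : ℕ) (α β : ℂ)
    (φ ψ : Fin D → (ι → ℂ) × ℂ),
    (∀ m : ι →₀ ℕ, (α • ∏ π, affVal (φ π) + β • ∏ π, affVal (ψ π)).coeff m = 0 ∨
      (α • ∏ π, affVal (φ π) + β • ∏ π, affVal (ψ π)).coeff m = 1) →
    formulaSizeOver monotoneBasis (fun a : ι → Bool =>
        decide (∃ m ∈ (α • ∏ π, affVal (φ π) + β • ∏ π, affVal (ψ π)).support,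
          ∀ i ∈ m.support, a i = true)) ≤ (Fintype.card ι + D + 2) ^ K

/-- **AFFINE COVERS ARE SHALLOW** (stub statement, named; Fourier-lift calibration, card
fourier-lift-logrank): if `𝒜 ⊆ {0,1}ⁿ` is covered by `k ≤ M` affine subspaces over `𝔽₂`, the
`j`-th cut out by the `≤ D` parity constraints `H j` (pairs (set, bit): `Σ_{i ∈ set} a_i = bit`),
then the shadow of the lift `Σ_{a ∈ 𝒜} Π_i X_{(i, a_i)}` — box-SAT of `𝒜` — has monotone formulas
of size `≤ (M+1) · 2^(K D) · (n+2)^K`: Bob reports an empty block or Alice names her piece, Bob a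
violated combination of its parities (Fredholm alternative over `𝔽₂`), and a parity binary search
finds a differing fixed coordinate. [folklore protocol; KarchmerWigderson1990 §2;
arXiv:1304.1245 (context)] -/
def AffineCoverShallow : Prop :=
  ∃ K : ℕ, ∀ (n M D : ℕ) (𝒜 : Finset (Fin n → Bool)),
    (∃ (k : ℕ) (H : Fin k → Finset (Finset (Fin n) × Bool)), k ≤ M ∧ (∀ j, (H j).card ≤ D) ∧
      ∀ a : Fin n → Bool, a ∈ 𝒜 ↔ ∃ j, ∀ p ∈ H j,
        (∑ i ∈ p.1, (if a i then (1 : ZMod 2) else 0)) = (if p.2 then 1 else 0)) →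
    formulaSizeOver monotoneBasis (fun x : Fin n × Bool → Bool =>
        decide (∃ m ∈ (∑ a ∈ 𝒜, ∏ i : Fin n,
            (MvPolynomial.X (i, a i) : MvPolynomial (Fin n × Bool) ℂ)).support,
          ∀ q ∈ m.support, x q = true)) ≤ (M + 1) * 2 ^ (K * D) * (n + 2) ^ K

/-- **TWO PRODUCTS, DEAD CASE** (stub statement, named; the (·,B1) half of the T = 2 game): if
every `B = 0` restriction kills one of the `2D` affine forms, the shadow of `α Π φ + β Π ψ` has
monotone formula size `≤ 16 (D+1)² (N+1)` — no `0/1` hypothesis needed (Bob names a dead form of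
each product, Alice a live variable of one of them). [folklore; KarchmerWigderson1990 §2] -/
def TwoProductDeadCase : Prop :=
  ∀ (ι : Type) [Fintype ι] [DecidableEq ι] (D : ℕ) (α β : ℂ) (φ ψ : Fin D → (ι → ℂ) × ℂ),
    (∀ b : ι → Bool,
      (¬ ∃ m ∈ (α • ∏ π, affVal (φ π) + β • ∏ π, affVal (ψ π)).support, ∀ i ∈ m.support, b i = true) →
      ∃ π : Fin D,
        MvPolynomial.bind₁ (fun l => if b l then (MvPolynomial.X l : MvPolynomial ι ℂ) else 0)
            (affVal (φ π)) = 0 ∨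
        MvPolynomial.bind₁ (fun l => if b l then (MvPolynomial.X l : MvPolynomial ι ℂ) else 0)
            (affVal (ψ π)) = 0) →
    formulaSizeOver monotoneBasis (fun a : ι → Bool =>
        decide (∃ m ∈ (α • ∏ π, affVal (φ π) + β • ∏ π, affVal (ψ π)).support,
          ∀ i ∈ m.support, a i = true)) ≤ 16 * (D + 1) ^ 2 * (Fintype.card ι + 1)

/-- **GRID RIGIDITY** (stub statement, named; negative calibration of the T = 2 attack): the
rows-versus-columns pair `α Π_π (Σ_κ c_{πκ} X_{πκ}) + β Π_κ (Σ_π c'_{πκ} X_{πκ})` on the full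
`D × D` grid (`D ≥ 3`, all `c, c' ≠ 0`, `α, β ≠ 0`) — whose cancelling restrictions realise
EVERY perfect matching — is never `0/1`: some coefficient is neither `0` nor `1` (rows of `c`
and columns of `c'` are forced constant, and then every bijection has coefficient `2`). [folklore;
this line, cycle 1] -/
def GridRigidity : Prop :=
  ∀ (D : ℕ), 3 ≤ D → ∀ (α β : ℂ) (c c' : Fin D → Fin D → ℂ), α ≠ 0 → β ≠ 0 →
    (∀ π κ, c π κ ≠ 0) → (∀ π κ, c' π κ ≠ 0) →
    ∃ m : Fin D × Fin D →₀ ℕ,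
      (α • ∏ π : Fin D, (∑ κ : Fin D, c π κ • (MvPolynomial.X (π, κ) : MvPolynomial (Fin D × Fin D) ℂ)) +
        β • ∏ κ : Fin D, (∑ π : Fin D, c' π κ •
          (MvPolynomial.X (π, κ) : MvPolynomial (Fin D × Fin D) ℂ))).coeff m ≠ 0 ∧
      (α • ∏ π : Fin D, (∑ κ : Fin D, c π κ • (MvPolynomial.X (π, κ) : MvPolynomial (Fin D × Fin D) ℂ)) +
        β • ∏ κ : Fin D, (∑ π : Fin D, c' π κ •
          (MvPolynomial.X (π, κ) : MvPolynomial (Fin D × Fin D) ℂ))).coeff m ≠ 1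

/-- **FAR SIDE OF THE BET** (stub statement, named; calibration of its strength): `Depth3Shadow`
together with Raz–Wigderson forces every `ΣΠΣ` representation of `per_m` with `D ≤ 2^{⌊√m⌋}`
affine factors per term to have top fan-in `T ≥ 2^{√m}` eventually — exponential depth-three
lower bounds for the permanent over `ℂ`, where only polynomial ones are in print.
[folklore; RazWigderson1992 (far side)] -/
def BetFarSide : Prop :=
  (∃ κ : ℝ, κ < 2 ∧ ∃ K : ℕ, ∀ (ι : Type) [Fintype ι] [DecidableEq ι] (T D : ℕ) (c : Fin T → ℂ)
    (ℓ : Fin T → Fin D → (ι → ℂ) × ℂ),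
    (∀ m : ι →₀ ℕ, (∑ τ, c τ • ∏ π, affVal (ℓ τ π)).coeff m = 0 ∨
      (∑ τ, c τ • ∏ π, affVal (ℓ τ π)).coeff m = 1) →
    Real.logb 2 ((formulaSizeOver monotoneBasis (fun a : ι → Bool =>
        decide (∃ m ∈ (∑ τ, c τ • ∏ π, affVal (ℓ τ π)).support, ∀ i ∈ m.support, a i = true)) : ℝ)
        + 1) ≤
      Real.logb 2 (T + 2) ^ κ * Real.logb 2 (Fintype.card ι + 2) ^ K + K * Real.logb 2 (D + 2) + K) →
  RazWigdersonMatching →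
  ∃ m₀ : ℕ, ∀ m ≥ m₀, ∀ (T D : ℕ) (c : Fin T → ℂ) (ℓ : Fin T → Fin D → (Fin m × Fin m → ℂ) × ℂ),
    (∑ τ, c τ • ∏ π, affVal (ℓ τ π)) = perPoly (Fin m) ℂ → D ≤ 2 ^ Nat.sqrt m →
      (2 : ℝ) ^ Real.sqrt m ≤ T

/-! ## The stubs (registered obligations; signatures = the named statements verbatim) -/

/-- Stub Depth3Shadow — OPEN, the line's bet (held by the lead).
[conjecture-grade: arXiv:1002.0145, RazWigderson1992, arXiv:2512.19515] -/
theorem stub_depth3Shadow :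
    ∃ κ : ℝ, κ < 2 ∧ ∃ K : ℕ, ∀ (ι : Type) [Fintype ι] [DecidableEq ι] (T D : ℕ) (c : Fin T → ℂ)
      (ℓ : Fin T → Fin D → (ι → ℂ) × ℂ),
      (∀ m : ι →₀ ℕ, (∑ τ, c τ • ∏ π, affVal (ℓ τ π)).coeff m = 0 ∨
        (∑ τ, c τ • ∏ π, affVal (ℓ τ π)).coeff m = 1) →
      Real.logb 2 ((formulaSizeOver monotoneBasis (fun a : ι → Bool =>
          decide (∃ m ∈ (∑ τ, c τ • ∏ π, affVal (ℓ τ π)).support, ∀ i ∈ m.support, a i = true)) : ℝ)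
          + 1) ≤
        Real.logb 2 (T + 2) ^ κ * Real.logb 2 (Fintype.card ι + 2) ^ K + K * Real.logb 2 (D + 2) + K := by
  sorry

/-- Stub SpsData (explicit `ΣΠΣ` data from a product-depth-`≤ 1` circuit). LANDED (worker,
wave 1): `Theorems/ShallowShadowsShadowFormulaTransferSpsData.lean` (p167670). [folklore] -/
theorem stub_spsData :
    ∀ (ι : Type) [Fintype ι] [DecidableEq ι] (P : ArithCircuit ℂ ι), P.productDepth ≤ 1 →
      ∃ (T D : ℕ) (c : Fin T → ℂ) (ℓ : Fin T → Fin D → (ι → ℂ) × ℂ),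
        (∑ τ, c τ • ∏ π, affVal (ℓ τ π)) = P.eval ∧ T ≤ P.edgeSize + 1 ∧ D ≤ P.edgeSize + 1 :=
  _root_.Summit.ValiantsHypothesis.ValiantsHypothesis.Theorems.ShallowShadowsShadowFormulaTransfer.stub_spsData

/-- Stub Window (the real bookkeeping of the composition). LANDED (worker, wave 1):
`Theorems/ShallowShadowsShadowFormulaTransferWindow.lean` (p168104). [folklore] -/
theorem stub_window :
    ∀ (κ : ℝ) (K : ℕ), 1 ≤ κ → κ ≤ 2 → ∃ C : ℕ, ∀ (K₁ c : ℕ), ∃ n₀ : ℕ,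
      ∀ (n d m s N T D : ℕ), n₀ ≤ n → 1 ≤ d → m ≤ (n + 2) ^ c → s ≤ (n + 2) ^ c →
        N ≤ (n + 2) ^ c →
        T + 2 ≤ 2 ^ (K₁ * Nat.sqrt (d * (Nat.log 2 m + 1) * (Nat.log 2 s + 1)) + K₁ + 2) →
        D + 2 ≤ 2 ^ (K₁ * Nat.sqrt (d * (Nat.log 2 m + 1) * (Nat.log 2 s + 1)) + K₁ + 2) →
        Real.logb 2 (T + 2) ^ κ * Real.logb 2 (N + 2) ^ K + K * Real.logb 2 (D + 2) + K ≤
          (d : ℝ) ^ (κ / 2) * Real.log (n + 2) ^ C + C :=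
  _root_.Summit.ValiantsHypothesis.ValiantsHypothesis.Theorems.ShallowShadowsShadowFormulaTransfer.stub_window

/-- Stub OneProductShadow (first bite `T ≤ 1`). LANDED (worker, wave 1):
`Theorems/ShallowShadowsShadowFormulaTransferOneProductShadow.lean` (p168541).
[folklore; KarchmerWigderson1990 §2] -/
theorem stub_oneProductShadow :
    ∀ (ι : Type) [Fintype ι] [DecidableEq ι] (D : ℕ) (c : ℂ) (ℓ : Fin D → (ι → ℂ) × ℂ),
      formulaSizeOver monotoneBasis (fun a : ι → Bool =>
          decide (∃ m ∈ (c • ∏ π, affVal (ℓ π)).support, ∀ i ∈ m.support, a i = true)) ≤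
        4 * (D + 1) * (Fintype.card ι + 1) :=
  _root_.Summit.ValiantsHypothesis.ValiantsHypothesis.Theorems.ShallowShadowsShadowFormulaTransfer.stub_oneProductShadow

/-- Stub TwoProductShadow (first bite `T = 2`; held by the lead, disprover target).
[conjecture-grade: chasm3-identity-game card] -/
theorem stub_twoProductShadow :
    ∃ K : ℕ, ∀ (ι : Type) [Fintype ι] [DecidableEq ι] (D : ℕ) (α β : ℂ)
      (φ ψ : Fin D → (ι → ℂ) × ℂ),
      (∀ m : ι →₀ ℕ, (α • ∏ π, affVal (φ π) + β • ∏ π, affVal (ψ π)).coeff m = 0 ∨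
        (α • ∏ π, affVal (φ π) + β • ∏ π, affVal (ψ π)).coeff m = 1) →
      formulaSizeOver monotoneBasis (fun a : ι → Bool =>
          decide (∃ m ∈ (α • ∏ π, affVal (φ π) + β • ∏ π, affVal (ψ π)).support,
            ∀ i ∈ m.support, a i = true)) ≤ (Fintype.card ι + D + 2) ^ K := by
  sorry

/-- Stub AffineCoverShallow (Fourier-lift calibration). LANDED (worker, wave 1):
`Theorems/ShallowShadowsShadowFormulaTransferAffineCoverShallow.lean` (p169271; K = 8, with an
𝔽₂ Fredholm alternative by elimination and a generic parity binary-search protocol).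
[folklore protocol; KarchmerWigderson1990 §2] -/
theorem stub_affineCoverShallow :
    ∃ K : ℕ, ∀ (n M D : ℕ) (𝒜 : Finset (Fin n → Bool)),
      (∃ (k : ℕ) (H : Fin k → Finset (Finset (Fin n) × Bool)), k ≤ M ∧ (∀ j, (H j).card ≤ D) ∧
        ∀ a : Fin n → Bool, a ∈ 𝒜 ↔ ∃ j, ∀ p ∈ H j,
          (∑ i ∈ p.1, (if a i then (1 : ZMod 2) else 0)) = (if p.2 then 1 else 0)) →
      formulaSizeOver monotoneBasis (fun x : Fin n × Bool → Bool =>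
          decide (∃ m ∈ (∑ a ∈ 𝒜, ∏ i : Fin n,
              (MvPolynomial.X (i, a i) : MvPolynomial (Fin n × Bool) ℂ)).support,
            ∀ q ∈ m.support, x q = true)) ≤ (M + 1) * 2 ^ (K * D) * (n + 2) ^ K :=
  _root_.Summit.ValiantsHypothesis.ValiantsHypothesis.Theorems.ShallowShadowsShadowFormulaTransfer.stub_affineCoverShallow

/-- Stub TwoProductDeadCase (the (·,B1) half of T = 2). LANDED (worker, wave 2):
`Theorems/ShallowShadowsShadowFormulaTransferTwoProductDeadCase.lean` (p170024; in the dead case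
`B g = B(ΠU) ∨ B(ΠV)` exactly, an ∨ of two CNFs). [folklore] -/
theorem stub_twoProductDeadCase :
    ∀ (ι : Type) [Fintype ι] [DecidableEq ι] (D : ℕ) (α β : ℂ) (φ ψ : Fin D → (ι → ℂ) × ℂ),
      (∀ b : ι → Bool,
        (¬ ∃ m ∈ (α • ∏ π, affVal (φ π) + β • ∏ π, affVal (ψ π)).support, ∀ i ∈ m.support, b i = true) →
        ∃ π : Fin D,
          MvPolynomial.bind₁ (fun l => if b l then (MvPolynomial.X l : MvPolynomial ι ℂ) else 0)
              (affVal (φ π)) = 0 ∨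
          MvPolynomial.bind₁ (fun l => if b l then (MvPolynomial.X l : MvPolynomial ι ℂ) else 0)
              (affVal (ψ π)) = 0) →
      formulaSizeOver monotoneBasis (fun a : ι → Bool =>
          decide (∃ m ∈ (α • ∏ π, affVal (φ π) + β • ∏ π, affVal (ψ π)).support,
            ∀ i ∈ m.support, a i = true)) ≤ 16 * (D + 1) ^ 2 * (Fintype.card ι + 1) :=
  _root_.Summit.ValiantsHypothesis.ValiantsHypothesis.Theorems.ShallowShadowsShadowFormulaTransfer.stub_twoProductDeadCase

/-- Stub GridRigidity (negative calibration of the T = 2 attack). LANDED (worker, wave 2):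
`Theorems/ShallowShadowsShadowFormulaTransferGridRigidity.lean` (p170206; `3 ≤ D` is sharp). [folklore] -/
theorem stub_gridRigidity :
    ∀ (D : ℕ), 3 ≤ D → ∀ (α β : ℂ) (c c' : Fin D → Fin D → ℂ), α ≠ 0 → β ≠ 0 →
      (∀ π κ, c π κ ≠ 0) → (∀ π κ, c' π κ ≠ 0) →
      ∃ m : Fin D × Fin D →₀ ℕ,
        (α • ∏ π : Fin D, (∑ κ : Fin D, c π κ • (MvPolynomial.X (π, κ) : MvPolynomial (Fin D × Fin D) ℂ)) +
          β • ∏ κ : Fin D, (∑ π : Fin D, c' π κ •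
            (MvPolynomial.X (π, κ) : MvPolynomial (Fin D × Fin D) ℂ))).coeff m ≠ 0 ∧
        (α • ∏ π : Fin D, (∑ κ : Fin D, c π κ • (MvPolynomial.X (π, κ) : MvPolynomial (Fin D × Fin D) ℂ)) +
          β • ∏ κ : Fin D, (∑ π : Fin D, c' π κ •
            (MvPolynomial.X (π, κ) : MvPolynomial (Fin D × Fin D) ℂ))).coeff m ≠ 1 :=
  _root_.Summit.ValiantsHypothesis.ValiantsHypothesis.Theorems.ShallowShadowsShadowFormulaTransfer.stub_gridRigidity

/-- Stub BetFarSide (the bet forces exponential ΣΠΣ lower bounds for per, modulo RW92). LANDED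
(worker, wave 2): `Theorems/ShallowShadowsShadowFormulaTransferBetFarSide.lean` (p170510). [folklore] -/
theorem stub_betFarSide :
    (∃ κ : ℝ, κ < 2 ∧ ∃ K : ℕ, ∀ (ι : Type) [Fintype ι] [DecidableEq ι] (T D : ℕ) (c : Fin T → ℂ)
      (ℓ : Fin T → Fin D → (ι → ℂ) × ℂ),
      (∀ m : ι →₀ ℕ, (∑ τ, c τ • ∏ π, affVal (ℓ τ π)).coeff m = 0 ∨
        (∑ τ, c τ • ∏ π, affVal (ℓ τ π)).coeff m = 1) →
      Real.logb 2 ((formulaSizeOver monotoneBasis (fun a : ι → Bool =>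
          decide (∃ m ∈ (∑ τ, c τ • ∏ π, affVal (ℓ τ π)).support, ∀ i ∈ m.support, a i = true)) : ℝ)
          + 1) ≤
        Real.logb 2 (T + 2) ^ κ * Real.logb 2 (Fintype.card ι + 2) ^ K + K * Real.logb 2 (D + 2) + K) →
    RazWigdersonMatching →
    ∃ m₀ : ℕ, ∀ m ≥ m₀, ∀ (T D : ℕ) (c : Fin T → ℂ) (ℓ : Fin T → Fin D → (Fin m × Fin m → ℂ) × ℂ),
      (∑ τ, c τ • ∏ π, affVal (ℓ τ π)) = perPoly (Fin m) ℂ → D ≤ 2 ^ Nat.sqrt m →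
        (2 : ℝ) ^ Real.sqrt m ≤ T :=
  _root_.Summit.ValiantsHypothesis.ValiantsHypothesis.Theorems.ShallowShadowsShadowFormulaTransfer.stub_betFarSide

/-! ## Name-keyed aliases of the stub statements (hypotheses of the composition) -/
namespace Registered

/-- Alias of `Depth3Shadow` (= the signature of `stub_depth3Shadow`). -/
abbrev stub_depth3Shadow : Prop := Depth3Shadow
/-- Alias of `SpsData` (= the signature of `stub_spsData`). -/
abbrev stub_spsData : Prop := SpsData
/-- Alias of `Window` (= the signature of `stub_window`). -/
abbrev stub_window : Prop := Window
/-- Alias of `OneProductShadow` (= the signature of `stub_oneProductShadow`). -/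
abbrev stub_oneProductShadow : Prop := OneProductShadow
/-- Alias of `TwoProductShadow` (= the signature of `stub_twoProductShadow`). -/
abbrev stub_twoProductShadow : Prop := TwoProductShadow
/-- Alias of `AffineCoverShallow` (= the signature of `stub_affineCoverShallow`). -/
abbrev stub_affineCoverShallow : Prop := AffineCoverShallow
/-- Alias of `TwoProductDeadCase` (= the signature of `stub_twoProductDeadCase`). -/
abbrev stub_twoProductDeadCase : Prop := TwoProductDeadCase
/-- Alias of `GridRigidity` (= the signature of `stub_gridRigidity`). -/
abbrev stub_gridRigidity : Prop := GridRigidity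
/-- Alias of `BetFarSide` (= the signature of `stub_betFarSide`). -/
abbrev stub_betFarSide : Prop := BetFarSide

end Registered

/-! ## Proved glue -/

/-- A polynomial of total degree `0` has a CONSTANT shadow (every monomial in its support is the
empty one), so the shadow does not take both values. [folklore] -/
theorem shadow_const_of_totalDegree_eq_zero {ι : Type} {R : Type*} [CommSemiring R]
    (g : MvPolynomial ι R) (hd : g.totalDegree = 0) (B : (ι → Bool) → Bool)
    (hB : ∀ a, B a = true ↔ ∃ m ∈ g.support, ∀ i ∈ m.support, a i = true) :
    ¬ ((∃ a, B a = true) ∧ ∃ b, B b = false) := by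
  rintro ⟨⟨a, ha⟩, b, hb⟩
  obtain ⟨m, hm, -⟩ := (hB a).1 ha
  have hm0 : m = 0 := by
    have h := MvPolynomial.le_totalDegree hm
    rw [hd, Nat.le_zero] at h
    ext i
    by_contra hi
    have hi' : i ∈ m.support := Finsupp.mem_support_iff.2 hi
    have hle : m i ≤ m.sum fun _ e => e := by
      rw [Finsupp.sum]
      exact Finset.single_le_sum (f := fun j => m j) (fun _ _ => Nat.zero_le _) hi'
    rw [h, Nat.le_zero] at hle
    exact hi hle
  have hb' : B b = true := (hB b).2 ⟨m, hm, fun i hi => by simp [hm0] at hi⟩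
  rw [hb'] at hb
  exact Bool.noConfusion hb

/-- `T + 2 ≤ 2 ^ (e + 2)` whenever `T ≤ E + 1` and `E ≤ 2 ^ e`. [folklore] -/
theorem add_two_le_two_pow {T E e : ℕ} (hT : T ≤ E + 1) (hE : E ≤ 2 ^ e) :
    T + 2 ≤ 2 ^ (e + 2) := by
  have h1 : 1 ≤ 2 ^ e := Nat.one_le_two_pow
  calc T + 2 ≤ 2 ^ e + 3 := by omega
    _ ≤ 2 ^ e * 4 := by omega
    _ = 2 ^ (e + 2) := by rw [pow_add]; norm_num

/-- Two p-bounded quantities under one exponent: `A ≤ B^e₁`, `D ≤ B^e₂`, `2 ≤ B` give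
`A + D ≤ B^(e₁ + e₂ + e₃ + 1)`. [folklore] -/
theorem add_le_pow_of_le {A D B e₁ e₂ e₃ : ℕ} (hB : 2 ≤ B) (hA : A ≤ B ^ e₁) (hD : D ≤ B ^ e₂) :
    A + D ≤ B ^ (e₁ + e₂ + e₃ + 1) := by
  have h1 : B ^ e₁ ≤ B ^ (e₁ + e₂ + e₃) := Nat.pow_le_pow_right (by omega) (by omega)
  have h2 : B ^ e₂ ≤ B ^ (e₁ + e₂ + e₃) := Nat.pow_le_pow_right (by omega) (by omega)
  calc A + D ≤ 2 * B ^ (e₁ + e₂ + e₃) := by omega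
    _ ≤ B * B ^ (e₁ + e₂ + e₃) := Nat.mul_le_mul_right _ hB
    _ = B ^ (e₁ + e₂ + e₃ + 1) := by rw [pow_succ]; ring

/-! ## The composition -/

/-- **Composition** (the glue of the line, kernel-checked): for a `0/1` VP family `f` and a level
`n ≥ n₀`, either `deg f_n = 0` (constant shadow, junk value `0`), or: the PADDED CHASM (tree,
`stub_paddedChasm` at exponent `1` with the free size parameter `m = #σ n + deg f_n`) gives a
product-depth-`≤ 1` circuit with `≤ 2^e` wires, `e = K₁ ⌊√(d (log₂ m + 1)(log₂ s + 1))⌋ + K₁`,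
`s = L(f_n)`; `stub_spsData` turns it into `T, D ≤ 2^e + 1` explicit products of affine forms
summing to `f_n`; the bet `stub_depth3Shadow` bounds `log₂(L + 1)` by
`(log₂(T+2))^κ (log₂(N+2))^K + K log₂(D+2) + K` (its `κ₀ < 2` upgraded to `κ = max κ₀ 1`);
and `stub_window` absorbs every constant of the family into `n ≥ n₀`, giving
`log₂(L + 1) ≤ d^{κ/2} (log(n+2))^C + C`, i.e. X with `δ = 1 − κ/2 > 0`. [folklore] -/
theorem ShadowFormulaTransfer_of :
    Registered.stub_depth3Shadow → ShadowFormulaTransfer := by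
  intro hB
  -- the two LANDED composition stubs are discharged here (tree theorems, wired through the
  -- stub declarations above); only the bet remains a hypothesis
  have hS : Registered.stub_spsData := stub_spsData
  have hW : Registered.stub_window := stub_window
  obtain ⟨κ₀, hκ₀, K, hbet⟩ := hB
  set κ : ℝ := max κ₀ 1 with hκdef
  have hκ1 : 1 ≤ κ := le_max_right _ _
  have hκ2 : κ < 2 := max_lt hκ₀ (by norm_num)
  obtain ⟨C, hC⟩ := hW κ K hκ1 hκ2.le
  obtain ⟨K₁, hK₁⟩ :=
    Summit.ValiantsHypothesis.ValiantsHypothesis.Theorems.ChowBorderDepth3Depth3Chasm.stub_paddedChasm 1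
  refine ⟨1 - κ / 2, by linarith, C, ?_⟩
  intro σ _ _ f hVP h01
  obtain ⟨⟨hcard, hdeg⟩, hcompl⟩ := hVP
  obtain ⟨e₁, he₁⟩ := IsPBounded.exists_le_pow hcard
  obtain ⟨e₂, he₂⟩ := IsPBounded.exists_le_pow hdeg
  obtain ⟨e₃, he₃⟩ := IsPBounded.exists_le_pow hcompl
  obtain ⟨n₀, hn₀⟩ := hC K₁ (e₁ + e₂ + e₃ + 1)
  refine ⟨n₀, fun n hn => ?_⟩
  have hexp : (1 : ℝ) - (1 - κ / 2) = κ / 2 := by ring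
  rw [hexp]
  -- notation
  set g := f n with hg
  set d := g.totalDegree with hd
  set N := Fintype.card (σ n) with hN
  have hWpos : (0 : ℝ) ≤ (2 : ℝ) ^ ((d : ℝ) ^ (κ / 2) * Real.log (n + 2) ^ C + C) :=
    Real.rpow_nonneg (by norm_num) _
  -- any spelling of the shadow of `g` that is bounded by `2 ^ W` will do
  have key : ∀ (B₁ B₀ : (σ n → Bool) → Bool), (∀ a, B₁ a = B₀ a) →
      (formulaSizeOver monotoneBasis B₁ : ℝ) ≤
        (2 : ℝ) ^ ((d : ℝ) ^ (κ / 2) * Real.log (n + 2) ^ C + C) →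
      (formulaSizeOver monotoneBasis B₀ : ℝ) ≤
        (2 : ℝ) ^ ((d : ℝ) ^ (κ / 2) * Real.log (n + 2) ^ C + C) := by
    intro B₁ B₀ hB h
    have hBB : B₁ = B₀ := funext hB
    subst hBB
    exact h
  -- degree 0: the shadow is constant, junk value 0
  rcases Nat.eq_zero_or_pos d with hd0 | hdpos
  · have hnc := shadow_const_of_totalDegree_eq_zero g hd0
      (fun a : σ n → Bool => decide (∃ m ∈ g.support, ∀ i ∈ m.support, a i = true))
      (fun a => by simp only [decide_eq_true_eq])
    rw [formulaSizeOver_monotoneBasis_eq_zero_of_not_nonconst hnc]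
    push_cast
    exact hWpos
  -- degree ≥ 1: padded chasm
  set m := N + d with hm
  set s := complexity g with hs
  obtain ⟨P, hP, hpd, hE⟩ := hK₁ (τ := σ n) m s d g le_rfl
    (by rw [pow_one]; omega) (by rw [pow_one]; omega) le_rfl
  -- explicit ΣΠΣ data
  obtain ⟨T, D, c, ℓ, hrepr, hT, hD⟩ := hS (σ n) P hpd
  have hrepr' : (∑ τ, c τ • ∏ π, affVal (ℓ τ π)) = g := hrepr.trans hP
  -- the bet
  have hb := hbet (σ n) T D c ℓ (fun mo => by rw [hrepr']; exact h01 n mo)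
  rw [hrepr'] at hb
  -- the window
  set e := K₁ * Nat.sqrt (d * (Nat.log 2 m + 1) * (Nat.log 2 s + 1)) + K₁ with he
  have hT2 : T + 2 ≤ 2 ^ (e + 2) := add_two_le_two_pow hT hE
  have hD2 : D + 2 ≤ 2 ^ (e + 2) := add_two_le_two_pow hD hE
  have h2 : 2 ≤ n + 2 := by omega
  have hm' : m ≤ (n + 2) ^ (e₁ + e₂ + e₃ + 1) := add_le_pow_of_le h2 (he₁ n) (he₂ n)
  have hs' : s ≤ (n + 2) ^ (e₁ + e₂ + e₃ + 1) :=
    (he₃ n).trans (Nat.pow_le_pow_right (by omega) (by omega))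
  have hN' : N ≤ (n + 2) ^ (e₁ + e₂ + e₃ + 1) :=
    (he₁ n).trans (Nat.pow_le_pow_right (by omega) (by omega))
  have hwin := hn₀ n d m s N T D hn hdpos hm' hs' hN' hT2 hD2
  -- upgrade `κ₀` to `κ`
  have hlogT : 1 ≤ Real.logb 2 ((T : ℝ) + 2) := by
    rw [← Real.logb_self_eq_one (b := (2 : ℝ)) (by norm_num)]
    exact Real.logb_le_logb_of_le (by norm_num) (by norm_num)
      (by linarith [(Nat.cast_nonneg T : (0 : ℝ) ≤ T)])
  have hlogN : 0 ≤ Real.logb 2 ((N : ℝ) + 2) := Real.logb_nonneg (by norm_num) (by linarith)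
  have hup : Real.logb 2 ((T : ℝ) + 2) ^ κ₀ * Real.logb 2 ((N : ℝ) + 2) ^ K ≤
      Real.logb 2 ((T : ℝ) + 2) ^ κ * Real.logb 2 ((N : ℝ) + 2) ^ K :=
    mul_le_mul_of_nonneg_right (Real.rpow_le_rpow_of_exponent_le hlogT (le_max_left _ _))
      (pow_nonneg hlogN K)
  -- the chain: log₂(L + 1) ≤ W, hence L ≤ L + 1 ≤ 2 ^ W
  have hchain := (hb.trans (by linarith)).trans hwin
  rw [Real.logb_le_iff_le_rpow (by norm_num) (by positivity)] at hchain
  have hfin : ((formulaSizeOver monotoneBasis (fun a : σ n → Bool =>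
      decide (∃ m ∈ g.support, ∀ i ∈ m.support, a i = true)) : ℕ) : ℝ) ≤
      (2 : ℝ) ^ ((d : ℝ) ^ (κ / 2) * Real.log (n + 2) ^ C + C) := by linarith
  exact key _ _ (fun a => decide_eq_decide.mpr Iff.rfl) hfin

/-- Wiring check: after wave 1 `ShadowFormulaTransfer` is closed modulo the ONE open bet
`stub_depth3Shadow` (the first bites `stub_oneProductShadow` [landed], `stub_twoProductShadow`
[open, lead], `stub_affineCoverShallow` [landed] are calibrations of the bet, not hypotheses of the
composition). -/
example : ShadowFormulaTransfer :=
  ShadowFormulaTransfer_of stub_depth3Shadow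

end Summit.ValiantsHypothesis.ValiantsHypothesis.Cruxes.ShadowFormulaTransfer.Chasm3

end
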